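import Mathlib
import Literature.NumberTheory.Automorphic.ZhouLegendreGreenValuesProofs

/-!
# Holomorphy tools for `ContinuumFamily` (support item stmt-CriticalPhenomena-6052, route CardyUSTContinuation)

Generic complex-analysis lemmas used to continue the Miller–Werner family
`U(t, η) = t Z(u,η) / (Z(u,1-η) + t Z(u,η))`, `u = arccos(-t/2)/π`,
`Z(u,x) = x^{u/2} (1-x)^{1-3u/2} ₂F₁(u, 1-u; 2u; x)` analytically in `t`
(file `CardyUSTContinuationContinuumFamily.lean`):

* norm bounds for Pochhammer symbols and Gauss coefficients at complex parameters, and the cast of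
  the real Gauss series `₂F₁` to `ℂ`;
* the Gauss series `p ↦ ₂F₁(p, 1-p; 2p; x)` (`0 ≤ x < 1` real) is holomorphic in the complex
  parameter `p` on `{‖p‖ < 1, re p > 1/4}` (Weierstrass M-test, majorant the real series
  `Σ Aₙ(2,2,1/2) xⁿ`, Mathlib's `Complex.differentiableOn_tsum_of_summable_norm`);
* the branch `w ↦ -I log(I w + (1-w²)^{1/2})` of the complex arcsine: holomorphic where `1 - w²` and
  `I w + (1-w²)^{1/2}` lie in the slit plane, equal to `Real.arcsin` on `(-1,1)`; hence the
  complexified exponent `v(t) = 1/2 + arcsin(t/2)/π = arccos(-t/2)/π`.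

Everything is folklore; no new definitions (the functions appear as explicit lambdas).
-/

noncomputable section

open Set Filter Complex
open scoped Topology Real
open Literature.NumberTheory.Automorphic.LegendreP (ofReal_ascPochhammer_eval norm_ascPochhammer_eval_le
  summable_abs_ordinaryHypergeometricCoefficient_mul_pow)

namespace Summit.CriticalPhenomena.CardyFormulaZ2.Theorems.ContinuumFamilyExt

/-! ### Pochhammer symbols at complex arguments -/

-- `norm_ascPochhammer_eval_le` (`‖(a)ₙ‖ ≤ (A)ₙ` for `‖a‖ ≤ A`) and `ofReal_ascPochhammer_eval` are
-- reused from `Literature.NumberTheory.Automorphic.LegendreP` (ZhouLegendreGreenValuesProofs).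

/-- `(c₀)_n ≤ ‖(c)_n‖` whenever `0 < c₀ ≤ re c`. [folklore] -/
theorem ascPochhammer_eval_le_norm {c : ℂ} {c₀ : ℝ} (h0 : 0 < c₀) (hc : c₀ ≤ c.re) (n : ℕ) :
    (ascPochhammer ℝ n).eval c₀ ≤ ‖(ascPochhammer ℂ n).eval c‖ := by
  induction n with
  | zero => simp
  | succ n ih =>
    rw [ascPochhammer_succ_eval, ascPochhammer_succ_eval, norm_mul]
    have h1 : c₀ + n ≤ ‖c + (n : ℂ)‖ := by
      refine le_trans ?_ (Complex.re_le_norm _)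
      simp only [Complex.add_re, Complex.natCast_re]
      exact add_le_add hc le_rfl
    have h2 : 0 ≤ c₀ + n := by positivity
    have h3 : 0 ≤ (ascPochhammer ℝ n).eval c₀ := (ascPochhammer_pos n c₀ h0).le
    exact mul_le_mul ih h1 h2 (le_trans h3 ih)

/-- `(c)_n ≠ 0` for `re c > 0`. [folklore] -/
theorem ascPochhammer_eval_ne_zero_of_re_pos {c : ℂ} (hc : 0 < c.re) (n : ℕ) :
    (ascPochhammer ℂ n).eval c ≠ 0 := by
  have h := ascPochhammer_eval_le_norm hc le_rfl n
  have hpos : 0 < (ascPochhammer ℝ n).eval c.re := ascPochhammer_pos n c.re hc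
  intro hz
  rw [hz, norm_zero] at h
  linarith

/-- The real Gauss coefficient `Aₙ(a,b,c)` cast to `ℂ` is the complex one. [folklore] -/
theorem ofReal_ordinaryHypergeometricCoefficient (a b c : ℝ) (n : ℕ) :
    ((ordinaryHypergeometricCoefficient a b c n : ℝ) : ℂ) =
      ordinaryHypergeometricCoefficient (a : ℂ) (b : ℂ) (c : ℂ) n := by
  simp only [ordinaryHypergeometricCoefficient]
  push_cast
  rw [ofReal_ascPochhammer_eval, ofReal_ascPochhammer_eval, ofReal_ascPochhammer_eval]

/-- The real hypergeometric function cast to `ℂ`: `↑(₂F₁ a b c x) = ₂F₁ ↑a ↑b ↑c ↑x` (both sides are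
the `tsum`s of the same series). [folklore] -/
theorem ofReal_ordinaryHypergeometric (a b c x : ℝ) :
    ((₂F₁ a b c x : ℝ) : ℂ) = ₂F₁ (a : ℂ) (b : ℂ) (c : ℂ) (x : ℂ) := by
  rw [ordinaryHypergeometric_eq_tsum, ordinaryHypergeometric_eq_tsum]
  simp only [smul_eq_mul]
  rw [Complex.ofReal_tsum]
  refine tsum_congr fun n => ?_
  have h := ofReal_ordinaryHypergeometricCoefficient a b c n
  simp only [ordinaryHypergeometricCoefficient] at h
  push_cast at h ⊢
  rw [h]

/-- Norm bound for the complex Gauss coefficients: if `‖a‖, ‖b‖ ≤ A` and `0 < c₀ ≤ re c` then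
`‖Aₙ(a,b,c)‖ ≤ Aₙ(A,A,c₀)`. [folklore] -/
theorem norm_ordinaryHypergeometricCoefficient_le {a b c : ℂ} {A c₀ : ℝ} (ha : ‖a‖ ≤ A)
    (hb : ‖b‖ ≤ A) (h0 : 0 < c₀) (hc : c₀ ≤ c.re) (n : ℕ) :
    ‖ordinaryHypergeometricCoefficient a b c n‖ ≤ ordinaryHypergeometricCoefficient A A c₀ n := by
  simp only [ordinaryHypergeometricCoefficient, norm_mul, norm_inv, Complex.norm_natCast]
  have h1 := norm_ascPochhammer_eval_le ha n
  have h2 := norm_ascPochhammer_eval_le hb n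
  have h3 := ascPochhammer_eval_le_norm h0 hc n
  have hpos : 0 < (ascPochhammer ℝ n).eval c₀ := ascPochhammer_pos n c₀ h0
  have hA : 0 ≤ (ascPochhammer ℝ n).eval A := le_trans (norm_nonneg _) h1
  have h3' : ‖(ascPochhammer ℂ n).eval c‖⁻¹ ≤ ((ascPochhammer ℝ n).eval c₀)⁻¹ := inv_anti₀ hpos h3
  have hfac : 0 ≤ ((n.factorial : ℝ))⁻¹ := by positivity
  calc ((n.factorial : ℝ))⁻¹ * ‖(ascPochhammer ℂ n).eval a‖ * ‖(ascPochhammer ℂ n).eval b‖ *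
        ‖(ascPochhammer ℂ n).eval c‖⁻¹
      ≤ ((n.factorial : ℝ))⁻¹ * (ascPochhammer ℝ n).eval A * (ascPochhammer ℝ n).eval A *
        ((ascPochhammer ℝ n).eval c₀)⁻¹ := by
        gcongr
  _ = _ := by rfl

/-- The parameter region `{‖p‖ < 1, re p > 1/4}` is open. [folklore] -/
theorem isOpen_paramRegion : IsOpen {p : ℂ | ‖p‖ < 1 ∧ 1 / 4 < p.re} :=
  (isOpen_lt continuous_norm continuous_const).inter
    (isOpen_lt continuous_const Complex.continuous_re)

/-! ### The Gauss series `₂F₁(p, 1-p; 2p; x)` as a holomorphic function of the parameter `p` -/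

/-- For real `0 ≤ x < 1`, the map `p ↦ ₂F₁(p, 1-p; 2p; x)` is holomorphic on the parameter region
`{‖p‖ < 1, re p > 1/4}` (Weierstrass M-test with majorant `Σ Aₙ(2,2,1/2) xⁿ`). [folklore] -/
theorem differentiableOn_ordinaryHypergeometric_param {x : ℝ} (hx0 : 0 ≤ x) (hx1 : x < 1) :
    DifferentiableOn ℂ (fun p : ℂ => ₂F₁ p (1 - p) (2 * p) (x : ℂ))
      {p : ℂ | ‖p‖ < 1 ∧ 1 / 4 < p.re} := by
  have hopen : IsOpen {p : ℂ | ‖p‖ < 1 ∧ 1 / 4 < p.re} := isOpen_paramRegion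
  have hsum := summable_abs_ordinaryHypergeometricCoefficient_mul_pow 2 2 (1 / 2) x hx0 hx1
  have hF : ∀ n : ℕ, DifferentiableOn ℂ
      (fun p : ℂ => ordinaryHypergeometricCoefficient p (1 - p) (2 * p) n * (x : ℂ) ^ n)
      {p : ℂ | ‖p‖ < 1 ∧ 1 / 4 < p.re} := by
    intro n p hp
    have hre : 0 < (2 * p).re := by
      have : (2 * p).re = 2 * p.re := by simp
      rw [this]; linarith [hp.2]
    have hne := ascPochhammer_eval_ne_zero_of_re_pos hre n
    apply DifferentiableAt.differentiableWithinAt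
    simp only [ordinaryHypergeometricCoefficient]
    have h1 : DifferentiableAt ℂ (fun p : ℂ => (ascPochhammer ℂ n).eval p) p :=
      (Polynomial.differentiable _).differentiableAt
    have h2 : DifferentiableAt ℂ (fun p : ℂ => (ascPochhammer ℂ n).eval (1 - p)) p := by
      have hg : DifferentiableAt ℂ (fun p : ℂ => 1 - p) p :=
        (differentiableAt_const _).sub differentiableAt_id
      exact ((Polynomial.differentiable (ascPochhammer ℂ n)) (1 - p)).comp p hg
    have h3 : DifferentiableAt ℂ (fun p : ℂ => (ascPochhammer ℂ n).eval (2 * p)) p := by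
      have hg : DifferentiableAt ℂ (fun p : ℂ => 2 * p) p := differentiableAt_id.const_mul _
      exact ((Polynomial.differentiable (ascPochhammer ℂ n)) (2 * p)).comp p hg
    exact ((((differentiableAt_const _).mul h1).mul h2).mul (h3.inv hne)).mul
      (differentiableAt_const _)
  have hle : ∀ (n : ℕ) (p : ℂ), p ∈ {p : ℂ | ‖p‖ < 1 ∧ 1 / 4 < p.re} →
      ‖ordinaryHypergeometricCoefficient p (1 - p) (2 * p) n * (x : ℂ) ^ n‖ ≤
        |ordinaryHypergeometricCoefficient (2 : ℝ) 2 (1 / 2) n| * x ^ n := by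
    intro n p hp
    rw [norm_mul, norm_pow, Complex.norm_real, Real.norm_eq_abs, abs_of_nonneg hx0]
    refine mul_le_mul_of_nonneg_right ?_ (pow_nonneg hx0 n)
    refine le_trans ?_ (le_abs_self _)
    refine norm_ordinaryHypergeometricCoefficient_le ?_ ?_ (by norm_num) ?_ n
    · linarith [hp.1]
    · calc ‖1 - p‖ ≤ ‖(1 : ℂ)‖ + ‖p‖ := norm_sub_le _ _
        _ ≤ 2 := by rw [norm_one]; linarith [hp.1]
    · have : (2 * p).re = 2 * p.re := by simp
      rw [this]; linarith [hp.2]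
  have h := Complex.differentiableOn_tsum_of_summable_norm hsum hF hopen hle
  refine h.congr fun p _ => ?_
  rw [ordinaryHypergeometric_eq_tsum]
  simp only [smul_eq_mul]

/-! ### A holomorphic arcsine -/

/-- On real points `s ∈ (-1,1)`: `(1 - s²)^{1/2} = √(1-s²)` in `ℂ`. [folklore] -/
theorem one_sub_sq_cpow_half_ofReal {s : ℝ} (hs : s ∈ Ioo (-1 : ℝ) 1) :
    ((1 : ℂ) - (s : ℂ) ^ 2) ^ ((1 : ℂ) / 2) = ((Real.sqrt (1 - s ^ 2) : ℝ) : ℂ) := by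
  have h0 : 0 ≤ 1 - s ^ 2 := by nlinarith [hs.1, hs.2]
  rw [Real.sqrt_eq_rpow, Complex.ofReal_cpow h0]
  push_cast
  ring_nf

/-- On real points `s ∈ (-1,1)`: `I s + (1 - s²)^{1/2} = exp(i · arcsin s)`. [folklore] -/
theorem I_mul_add_cpow_half_ofReal {s : ℝ} (hs : s ∈ Ioo (-1 : ℝ) 1) :
    I * (s : ℂ) + ((1 : ℂ) - (s : ℂ) ^ 2) ^ ((1 : ℂ) / 2) =
      Complex.exp ((Real.arcsin s : ℂ) * I) := by
  rw [one_sub_sq_cpow_half_ofReal hs, Complex.exp_mul_I, ← Complex.ofReal_cos, ← Complex.ofReal_sin,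
    Real.cos_arcsin, Real.sin_arcsin hs.1.le hs.2.le]
  ring

/-- The branch `w ↦ -I log(I w + (1-w²)^{1/2})` of the complex arcsine restricts to `Real.arcsin`
on `(-1,1)`, and both `1 - s²` and `I s + (1-s²)^{1/2}` lie in the slit plane there. [folklore] -/
theorem casin_ofReal {s : ℝ} (hs : s ∈ Ioo (-1 : ℝ) 1) :
    (1 : ℂ) - (s : ℂ) ^ 2 ∈ slitPlane ∧
    I * (s : ℂ) + ((1 : ℂ) - (s : ℂ) ^ 2) ^ ((1 : ℂ) / 2) ∈ slitPlane ∧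
    -I * Complex.log (I * (s : ℂ) + ((1 : ℂ) - (s : ℂ) ^ 2) ^ ((1 : ℂ) / 2)) =
      (Real.arcsin s : ℂ) := by
  have h0 : 0 < 1 - s ^ 2 := by nlinarith [hs.1, hs.2]
  refine ⟨?_, ?_, ?_⟩
  · have : (1 : ℂ) - (s : ℂ) ^ 2 = ((1 - s ^ 2 : ℝ) : ℂ) := by push_cast; ring
    rw [this, Complex.ofReal_mem_slitPlane]
    exact h0
  · rw [I_mul_add_cpow_half_ofReal hs]
    refine Complex.mem_slitPlane_iff.2 (Or.inl ?_)
    rw [Complex.exp_ofReal_mul_I_re, Real.cos_arcsin]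
    exact Real.sqrt_pos.2 h0
  · rw [I_mul_add_cpow_half_ofReal hs, Complex.log_exp]
    · rw [show -I * ((Real.arcsin s : ℂ) * I) = -(I * I) * (Real.arcsin s : ℂ) by ring,
        Complex.I_mul_I]
      ring
    · have : ((Real.arcsin s : ℂ) * I).im = Real.arcsin s := by simp
      rw [this]
      linarith [Real.pi_pos, Real.neg_pi_div_two_le_arcsin s]
    · have : ((Real.arcsin s : ℂ) * I).im = Real.arcsin s := by simp
      rw [this]
      linarith [Real.pi_pos, Real.arcsin_le_pi_div_two s]

/-- The branch of the complex arcsine is holomorphic wherever `1 - w²` and `I w + (1-w²)^{1/2}`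
lie in the slit plane; its argument `I w + (1-w²)^{1/2}` is continuous there. [folklore] -/
theorem differentiableAt_casin {w : ℂ} (h1 : (1 : ℂ) - w ^ 2 ∈ slitPlane)
    (h2 : I * w + ((1 : ℂ) - w ^ 2) ^ ((1 : ℂ) / 2) ∈ slitPlane) :
    DifferentiableAt ℂ
        (fun w : ℂ => -I * Complex.log (I * w + ((1 : ℂ) - w ^ 2) ^ ((1 : ℂ) / 2))) w ∧
      ContinuousAt (fun w : ℂ => I * w + ((1 : ℂ) - w ^ 2) ^ ((1 : ℂ) / 2)) w := by
  have hA : DifferentiableAt ℂ (fun w : ℂ => I * w + ((1 : ℂ) - w ^ 2) ^ ((1 : ℂ) / 2)) w := by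
    refine ((differentiableAt_const _).mul differentiableAt_id).add ?_
    exact ((differentiableAt_const _).sub (differentiableAt_id.pow 2)).cpow
      (differentiableAt_const _) h1
  exact ⟨(differentiableAt_const _).mul (hA.clog h2), hA.continuousAt⟩

/-- The complexified exponent `v(t) = 1/2 + arcsin(t/2)/π` (`= arccos(-t/2)/π` on real `t`): on real
`t ∈ (-2, 2)` the two slit-plane conditions hold at `w = t/2` and `v(t) = arccos(-t/2)/π`.
[folklore] -/
theorem cexponent_ofReal {t : ℝ} (ht : t ∈ Ioo (-2 : ℝ) 2) :
    (1 : ℂ) - ((t : ℂ) / 2) ^ 2 ∈ slitPlane ∧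
    I * ((t : ℂ) / 2) + ((1 : ℂ) - ((t : ℂ) / 2) ^ 2) ^ ((1 : ℂ) / 2) ∈ slitPlane ∧
    (1 : ℂ) / 2 + -I * Complex.log (I * ((t : ℂ) / 2) + ((1 : ℂ) - ((t : ℂ) / 2) ^ 2) ^ ((1 : ℂ) / 2)) /
        (Real.pi : ℂ) = ((Real.arccos (-(t / 2)) / Real.pi : ℝ) : ℂ) := by
  have hs : t / 2 ∈ Ioo (-1 : ℝ) 1 := ⟨by linarith [ht.1], by linarith [ht.2]⟩
  obtain ⟨h1, h2, h3⟩ := casin_ofReal hs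
  push_cast at h1 h2 h3
  refine ⟨h1, h2, ?_⟩
  rw [h3, Real.arccos_eq_pi_div_two_sub_arcsin, Real.arcsin_neg]
  have hπ : (Real.pi : ℂ) ≠ 0 := Complex.ofReal_ne_zero.2 Real.pi_ne_zero
  push_cast
  field_simp
  ring

/-- The complexified exponent is holomorphic (hence continuous) wherever the two slit-plane
conditions hold. [folklore] -/
theorem differentiableAt_cexponent {t : ℂ} (h1 : (1 : ℂ) - (t / 2) ^ 2 ∈ slitPlane)
    (h2 : I * (t / 2) + ((1 : ℂ) - (t / 2) ^ 2) ^ ((1 : ℂ) / 2) ∈ slitPlane) :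
    DifferentiableAt ℂ (fun t : ℂ => (1 : ℂ) / 2 +
        -I * Complex.log (I * (t / 2) + ((1 : ℂ) - (t / 2) ^ 2) ^ ((1 : ℂ) / 2)) / (Real.pi : ℂ)) t ∧
      ContinuousAt (fun t : ℂ => I * (t / 2) + ((1 : ℂ) - (t / 2) ^ 2) ^ ((1 : ℂ) / 2)) t := by
  obtain ⟨hd, hc⟩ := differentiableAt_casin h1 h2
  have hhalf : DifferentiableAt ℂ (fun t : ℂ => t / 2) t := differentiableAt_id.div_const 2
  refine ⟨(differentiableAt_const _).add ((hd.comp t hhalf).div_const _), ?_⟩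
  exact hc.comp (f := fun t : ℂ => t / 2) hhalf.continuousAt

end Summit.CriticalPhenomena.CardyFormulaZ2.Theorems.ContinuumFamilyExt
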